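import Summits.CriticalPhenomena.PercolationContinuityZ3.Theorems.PercNearOneGluingNoHeavyLowerTailQuantitativeOneSideSizeLemmaKey
import HarnessLib

/-!
# The ONE-SIDE SIZE LEMMA (BENCH row M2-R57, PROOFS §P56): `Cov(x↔a, b↔{x,a}) ≤ |L| · P(b↔a, b↮x)`

Support file (`--supports stmt-CriticalPhenomena-4575`), prover seat `prim-rate-mine-2` (lane prim-rate, constants-miner (c);
`run/shared/lean/prim/prim-rate/prim-rate-mine-2/PROOFS.md` §P54 (b), §P56; BENCH rows l.192 M2-R54, l.197 M2-R57).
No definitions, no named facts, no sorries; standard axioms.  Part 1 (one-pair plumbing and the KEY LEMMA) is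
`PercNearOneGluingNoHeavyLowerTailQuantitativeOneSideSizeLemmaKey.lean`.

SETTING.  Independent bond percolation with arbitrary pair weights `w : Sym2 V → [0,1]` on a finite vertex type `V`
(`μ = prodBernoulli w`), vertices `x, a, b`, events `A = {x ↔ a}`, `β = {b ↔ x} ∪ {b ↔ a}`, `J = {b ↔ a} ∩ {b ↮ x}`;
`φ = μ(A ∩ β) − μ(A)·μ(β)` (the ONE-SIDE COVARIANCE), `λ = μ(J)`.

* **`CSH.oneSideCov_le_count_mul`** — `φ ≤ k(w) · λ`, `k(w) = #{v ≠ x : 0 < μ(a ↔ v) < 1}` (vertices other than `x` that CAN be joined to `a` but are not a.s. glued to it — vertices outside the support component of `a` do not count);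
* **`CSH.oneSideCov_le_card_mul`** — hence, for `x ≠ a`, `φ ≤ (|V| − 2) · λ`: THE ONE-SIDE SIZE LEMMA (`|L| = |V| − 2`,
  `Λ := φ/λ ≤ |L|`; sharp along the hub–path sides, PROOFS §P54 (d1); referee mine-ref-g57 CONCUR on the paper proof);
* **`CSH.cov_conn_le_card_add_mul`** — the equivalent form `Cov(1{x↔a}, 1{x↔b}) ≤ (|V| − 2 + μ(x↔a)) · μ(b↔a, b↮x)`.

PROOF (PROOFS §P56).  Induction on the number of pairs with weight in `(0,1)`.  Pick `e = {z,v}` with `z` glued to `a`,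
`v` not, `0 < w_e < 1` (if there is none, every pair leaving the glued set has weight `0`, the cluster of `a` is a.s. the glued
set and `φ = 0`: `osl_oneSideCov_eq_zero_of_closed`).  With `ρ = w_e`: `φ = (1−ρ)φ⁰ + ρφ¹ + ρ(1−ρ)·I_A·I_β`
(`I_A = μ¹(A) − μ⁰(A)`, `I_β = μ¹(β) − μ⁰(β)`); the induction hypothesis gives `φ⁰ ≤ kλ⁰` and `φ¹ ≤ (k−1)λ¹` (`v` is glued
under `μ¹`; if `v = x` then `μ¹(A) = 1` and `φ¹ = 0`), the KEY LEMMA gives `I_A·I_β ≤ λ¹`, so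
`kλ − φ ≥ ρλ¹ − ρ(1−ρ)λ¹ = ρ²λ¹ ≥ 0`.  The paper's contraction `H/e` is replaced by forcing `w_e = 1` and counting un-glued
vertices, so no quotient graph is needed.  COROLLARIES (paper, PROOFS §P56 (C1)–(C2), not in this file): with the separator
identities, the SIZE LAW `c ≤ ⌊(n−2)²/4⌋/(n−2) − 1` on the whole separator class, and the pair-functional law `c_pair ≤ n − 3`.
[cite: VandenbergHaggstromKahn2005, Thm. 1.3 (p. 6)] [cite: Grimmett1999, §2.4 (conditioning on the state of one edge)]
-/

noncomputable section

namespace Summit.CriticalPhenomena.PercolationContinuityZ3.Theorems.CSH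

open MeasureTheory Set unitInterval
open Literature.Probability.LatticeModels (prodBernoulli prodBernoulli_real_setOf_mem prodBernoulli_ae_notMem)
open Literature.Probability.Percolation
open scoped Classical

variable {V : Type*} [Fintype V] [DecidableEq V]

/-! ### The degenerate case: no weighted pair leaves the glued set -/

omit [DecidableEq V] in
/-- If every pair from a vertex glued to `a` to an un-glued vertex has weight `0`, then the one-side covariance vanishes
(the cluster of `a` is almost surely the glued set, so `{x↔a}` is almost sure or null). [folklore] -/
private theorem osl_oneSideCov_eq_zero_of_closed (w : Sym2 V → unitInterval) (x a b : V)
    (hzero : ∀ z v : V, (prodBernoulli w).real (openConn a z) = 1 → (prodBernoulli w).real (openConn a v) ≠ 1 →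
      w s(z, v) = 0) :
    (prodBernoulli w).real ((openConn x a : Set (BondConfig V)) ∩ (openConn b x ∪ openConn b a)) -
        (prodBernoulli w).real (openConn x a) *
          (prodBernoulli w).real ((openConn b x : Set (BondConfig V)) ∪ openConn b a) = 0 := by
  set μ := prodBernoulli w with hμ
  set S : Set V := {v | μ.real (openConn a v) = 1} with hS
  have ha : a ∈ S := by
    change μ.real (openConn a a) = 1
    rw [show (openConn a a : Set (BondConfig V)) = Set.univ from Set.eq_univ_of_forall fun _ => SimpleGraph.Reachable.refl _]; exact probReal_univ
  have hae : ∀ᵐ ω ∂μ, ∀ z v : V, z ∈ S → v ∉ S → s(z, v) ∉ ω := by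
    rw [ae_all_iff]; intro z; rw [ae_all_iff]; intro v
    by_cases h : z ∈ S ∧ v ∉ S
    · exact (prodBernoulli_ae_notMem w (hzero z v h.1 h.2)).mono fun ω hω _ _ => hω
    · exact Filter.Eventually.of_forall fun ω hz hv => (h ⟨hz, hv⟩).elim
  set Ω₀ : Set (BondConfig V) := {ω | ∀ z v : V, z ∈ S → v ∉ S → s(z, v) ∉ ω} with hΩ₀
  have hΩ₀c : μ.real Ω₀ᶜ = 0 := by
    have h := ae_iff.1 hae
    rw [measureReal_def, show Ω₀ᶜ = {ω | ¬ ∀ z v : V, z ∈ S → v ∉ S → s(z, v) ∉ ω} from rfl, h]; rfl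
  have hcl : ∀ ω ∈ Ω₀, ∀ y, (openGraph ω).Reachable a y → y ∈ S := fun ω hω y hy =>
    osl_reachable_mem_of_closed ha (fun z hz v hv => hω z v hz hv) hy
  by_cases hx : x ∈ S
  · have hA : μ.real (openConn x a) = 1 := by rw [show (openConn x a : Set (BondConfig V)) = openConn a x from Set.ext fun _ => SimpleGraph.reachable_comm]; exact hx
    rw [osl_real_inter_of_eq_one μ hA, hA, one_mul, sub_self]
  · have hA0 : μ.real (openConn x a) = 0 := by
      apply le_antisymm _ measureReal_nonneg
      calc μ.real (openConn x a) ≤ μ.real Ω₀ᶜ := measureReal_mono fun ω hω hΩ =>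
              hx (hcl ω hΩ x (SimpleGraph.Reachable.symm hω))
        _ = 0 := hΩ₀c
    have hAβ : μ.real ((openConn x a : Set (BondConfig V)) ∩ (openConn b x ∪ openConn b a)) = 0 :=
      le_antisymm ((measureReal_mono Set.inter_subset_left).trans hA0.le) measureReal_nonneg
    rw [hAβ, hA0, zero_mul, sub_self]

/-! ### The induction -/

/-- The ONE-SIDE SIZE LEMMA with the glued-vertex count, by induction on the number of pairs of weight in `(0,1)`
(PROOFS §P56 (0)–(5)). [cite: VandenbergHaggstromKahn2005, Thm. 1.3 (p. 6)] -/
private theorem osl_induct (x a b : V) : ∀ (n : ℕ) (w : Sym2 V → unitInterval),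
    (Finset.univ.filter fun e : Sym2 V => w e ≠ 0 ∧ w e ≠ 1).card ≤ n →
    (prodBernoulli w).real ((openConn x a : Set (BondConfig V)) ∩ (openConn b x ∪ openConn b a)) -
        (prodBernoulli w).real (openConn x a) *
          (prodBernoulli w).real ((openConn b x : Set (BondConfig V)) ∪ openConn b a) ≤
      ((Finset.univ.filter fun v : V => v ≠ x ∧ 0 < (prodBernoulli w).real (openConn a v) ∧ (prodBernoulli w).real (openConn a v) < 1).card : ℝ) *
        (prodBernoulli w).real ((openConn b a : Set (BondConfig V)) ∩ (openConn b x)ᶜ) := by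
  intro n
  induction n with
  | zero =>
    intro w hw
    have hz : ∀ z v : V, (prodBernoulli w).real (openConn a z) = 1 →
        (prodBernoulli w).real (openConn a v) ≠ 1 → w s(z, v) = 0 := by
      intro z v _ _
      by_contra h0
      by_cases h1 : w s(z, v) = 1
      · exact absurd (osl_glued_of_weight_one w ‹_› h1) ‹_›
      · have : s(z, v) ∈ Finset.univ.filter fun e : Sym2 V => w e ≠ 0 ∧ w e ≠ 1 :=
          Finset.mem_filter.2 ⟨Finset.mem_univ _, h0, h1⟩
        exact absurd (Finset.card_pos.2 ⟨_, this⟩) (by omega)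
    rw [osl_oneSideCov_eq_zero_of_closed w x a b hz]
    exact mul_nonneg (Nat.cast_nonneg _) measureReal_nonneg
  | succ n ih =>
    intro w hw
    by_cases hex : ∃ z v : V, (prodBernoulli w).real (openConn a z) = 1 ∧
        (prodBernoulli w).real (openConn a v) < 1 ∧ w s(z, v) ≠ 0 ∧ w s(z, v) ≠ 1
    swap
    · -- degenerate case
      have hz : ∀ z v : V, (prodBernoulli w).real (openConn a z) = 1 →
          (prodBernoulli w).real (openConn a v) ≠ 1 → w s(z, v) = 0 := by
        intro z v hz hv
        by_contra h0
        by_cases h1 : w s(z, v) = 1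
        · exact hv (osl_glued_of_weight_one w hz h1)
        · exact hex ⟨z, v, hz, lt_of_le_of_ne measureReal_le_one hv, h0, h1⟩
      rw [osl_oneSideCov_eq_zero_of_closed w x a b hz]
      exact mul_nonneg (Nat.cast_nonneg _) measureReal_nonneg
    obtain ⟨z, v, hz, hv, hw0, hw1⟩ := hex
    -- notation
    set e : Sym2 V := s(z, v) with he
    set μ := prodBernoulli w with hμ
    set μ0 := prodBernoulli (Function.update w e 0) with hμ0
    set μ1 := prodBernoulli (Function.update w e 1) with hμ1
    set A : Set (BondConfig V) := openConn x a with hA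
    set β : Set (BondConfig V) := (openConn b x : Set (BondConfig V)) ∪ openConn b a with hβ
    set J : Set (BondConfig V) := (openConn b a : Set (BondConfig V)) ∩ (openConn b x)ᶜ with hJ
    have hzv : z ≠ v := by rintro rfl; exact absurd hz (ne_of_lt hv)
    have hρ0 : 0 < (w e : ℝ) := lt_of_le_of_ne (w e).2.1 (Ne.symm (unitInterval.coe_ne_zero.2 hw0))
    have hρ1 : (w e : ℝ) < 1 := lt_of_le_of_ne (w e).2.2 (unitInterval.coe_ne_one.2 hw1)
    set ρ : ℝ := (w e : ℝ) with hρ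
    -- gluing is preserved under both conditionings; `v` becomes glued under `μ1`
    have hglue : ∀ y : V, μ.real (openConn a y) = 1 →
        μ0.real (openConn a y) = 1 ∧ μ1.real (openConn a y) = 1 := fun y hy => osl_real_update_eq_one w hρ0 hρ1 hy
    have hv1 : μ1.real (openConn a v) = 1 :=
      osl_glued_of_weight_one (Function.update w e 1) (hglue z hz).2 (by rw [← he, Function.update_self])
    -- the pair counts drop
    have hmem : e ∈ Finset.univ.filter fun e' : Sym2 V => w e' ≠ 0 ∧ w e' ≠ 1 :=
      Finset.mem_filter.2 ⟨Finset.mem_univ _, hw0, hw1⟩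
    have hcard : ∀ t : unitInterval, (t = 0 ∨ t = 1) →
        (Finset.univ.filter fun e' : Sym2 V => Function.update w e t e' ≠ 0 ∧ Function.update w e t e' ≠ 1).card ≤ n := by
      intro t ht
      have hsub : (Finset.univ.filter fun e' : Sym2 V =>
            Function.update w e t e' ≠ 0 ∧ Function.update w e t e' ≠ 1) ⊆
          (Finset.univ.filter fun e' : Sym2 V => w e' ≠ 0 ∧ w e' ≠ 1).erase e := by
        intro e' he'
        rw [Finset.mem_filter] at he'
        rw [Finset.mem_erase, Finset.mem_filter]
        by_cases hee : e' = e
        · subst hee; rw [Function.update_self] at he'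
          rcases ht with rfl | rfl
          · exact absurd rfl he'.2.1
          · exact absurd rfl he'.2.2
        · rw [Function.update_of_ne hee] at he'
          exact ⟨hee, Finset.mem_univ _, he'.2⟩
      have := (Finset.card_le_card hsub).trans (Finset.card_erase_of_mem hmem).le
      omega
    have h0 := ih (Function.update w e 0) (hcard 0 (Or.inl rfl))
    have h1 := ih (Function.update w e 1) (hcard 1 (Or.inr rfl))
    -- the vertex counts
    set k : ℕ := (Finset.univ.filter fun v' : V => v' ≠ x ∧ 0 < μ.real (openConn a v') ∧ μ.real (openConn a v') < 1).card with hk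
    set k0 : ℕ := (Finset.univ.filter fun v' : V => v' ≠ x ∧ 0 < μ0.real (openConn a v') ∧ μ0.real (openConn a v') < 1).card with hk0
    set k1 : ℕ := (Finset.univ.filter fun v' : V => v' ≠ x ∧ 0 < μ1.real (openConn a v') ∧ μ1.real (openConn a v') < 1).card with hk1
    have hsub0 : (Finset.univ.filter fun v' : V => v' ≠ x ∧ 0 < μ0.real (openConn a v') ∧ μ0.real (openConn a v') < 1) ⊆
        (Finset.univ.filter fun v' : V => v' ≠ x ∧ 0 < μ.real (openConn a v') ∧ μ.real (openConn a v') < 1) := by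
      intro y hy
      rw [Finset.mem_filter] at hy ⊢
      refine ⟨hy.1, hy.2.1, ?_, lt_of_le_of_ne measureReal_le_one fun h => ?_⟩
      · have h1 := osl_real_onePair w e (openConn a y : Set (BondConfig V))
        have h2 : 0 ≤ μ1.real (openConn a y) := measureReal_nonneg
        have h3 : 0 < μ0.real (openConn a y) := hy.2.2.1
        rw [hμ, h1]; nlinarith
      · exact absurd (hglue y h).1 (ne_of_lt hy.2.2.2)
    have hsub1 : (Finset.univ.filter fun v' : V => v' ≠ x ∧ 0 < μ1.real (openConn a v') ∧ μ1.real (openConn a v') < 1) ⊆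
        (Finset.univ.filter fun v' : V => v' ≠ x ∧ 0 < μ.real (openConn a v') ∧ μ.real (openConn a v') < 1) := by
      intro y hy
      rw [Finset.mem_filter] at hy ⊢
      refine ⟨hy.1, hy.2.1, ?_, lt_of_le_of_ne measureReal_le_one fun h => ?_⟩
      · have h1 := osl_real_onePair w e (openConn a y : Set (BondConfig V))
        have h2 : 0 ≤ μ0.real (openConn a y) := measureReal_nonneg
        have h3 : 0 < μ1.real (openConn a y) := hy.2.2.1
        rw [hμ, h1]; nlinarith
      · exact absurd (hglue y h).2 (ne_of_lt hy.2.2.2)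
    have hk0k : (k0 : ℝ) ≤ k := by exact_mod_cast Finset.card_le_card hsub0
    have hl0 : 0 ≤ μ0.real J := measureReal_nonneg
    have hl1 : 0 ≤ μ1.real J := measureReal_nonneg
    have hφ0 : μ0.real (A ∩ β) - μ0.real A * μ0.real β ≤ (k : ℝ) * μ0.real J :=
      h0.trans (mul_le_mul_of_nonneg_right hk0k hl0)
    -- case `β` almost sure: `φ = 0`
    by_cases hβ1 : μ.real β = 1
    · have : μ.real (A ∩ β) = μ.real A := by rw [Set.inter_comm]; exact osl_real_inter_of_eq_one μ hβ1
      rw [this, hβ1, mul_one, sub_self]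
      exact mul_nonneg (Nat.cast_nonneg _) measureReal_nonneg
    -- case `a ↔ b` null: `μ(A ∩ β) = 0`, `φ ≤ 0`
    by_cases hb0 : μ.real (openConn a b) = 0
    · have hAβ : μ.real (A ∩ β) = 0 := by
        refine le_antisymm ((measureReal_mono ?_).trans hb0.le) measureReal_nonneg
        rintro ω ⟨hxa', hb | hb⟩
        · exact SimpleGraph.Reachable.trans (SimpleGraph.Reachable.symm hxa') (SimpleGraph.Reachable.symm hb)
        · exact SimpleGraph.Reachable.symm hb
      rw [hAβ, zero_sub]
      exact (neg_nonpos.2 (mul_nonneg measureReal_nonneg measureReal_nonneg)).trans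
        (mul_nonneg (Nat.cast_nonneg _) measureReal_nonneg)
    have hbpos : 0 < μ.real (openConn a b) := lt_of_le_of_ne measureReal_nonneg (Ne.symm hb0)
    -- otherwise `b` is counted, so `k ≥ 1`
    have hβlt : μ.real β < 1 := lt_of_le_of_ne measureReal_le_one hβ1
    have hbk : b ∈ Finset.univ.filter fun v' : V => v' ≠ x ∧ 0 < μ.real (openConn a v') ∧ μ.real (openConn a v') < 1 := by
      refine Finset.mem_filter.2 ⟨Finset.mem_univ _, ?_, hbpos, ?_⟩
      · rintro rfl
        apply hβ1
        apply le_antisymm measureReal_le_one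
        calc (1 : ℝ) = μ.real (Set.univ : Set (BondConfig V)) := probReal_univ.symm
          _ ≤ μ.real β := measureReal_mono fun ω _ => Or.inl (SimpleGraph.Reachable.refl _)
      · calc μ.real (openConn a b) = μ.real (openConn b a) := by rw [show (openConn a b : Set (BondConfig V)) = openConn b a from Set.ext fun _ => SimpleGraph.reachable_comm]
          _ ≤ μ.real β := measureReal_mono Set.subset_union_right
          _ < 1 := hβlt
    have hk1le : (1 : ℝ) ≤ k := by exact_mod_cast Finset.card_pos.2 ⟨b, hbk⟩
    -- `φ1 ≤ (k - 1) λ1`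
    have hφ1 : μ1.real (A ∩ β) - μ1.real A * μ1.real β ≤ ((k : ℝ) - 1) * μ1.real J := by
      by_cases hvx : v = x
      · have hA1 : μ1.real A = 1 := by rw [hA, show (openConn x a : Set (BondConfig V)) = openConn a x from Set.ext fun _ => SimpleGraph.reachable_comm, ← hvx]; exact hv1
        have : μ1.real (A ∩ β) = μ1.real β := osl_real_inter_of_eq_one μ1 hA1
        rw [this, hA1, one_mul, sub_self]
        exact mul_nonneg (by linarith) hl1
      · have hvpos : 0 < μ.real (openConn a v) := by
          have he1 : μ.real {ω : BondConfig V | e ∈ ω} = ρ := by rw [hμ, prodBernoulli_real_setOf_mem]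
          have hsub : (openConn a z : Set (BondConfig V)) ∩ {ω | e ∈ ω} ⊆ openConn a v := by
            rintro ω ⟨haz, hω⟩
            exact SimpleGraph.Reachable.trans haz (SimpleGraph.Adj.reachable ((openGraph_adj ω z v).2 ⟨hω, hzv⟩))
          calc (0 : ℝ) < ρ := hρ0
            _ = μ.real ((openConn a z : Set (BondConfig V)) ∩ {ω | e ∈ ω}) := by
                rw [osl_real_inter_of_eq_one μ hz, he1]
            _ ≤ μ.real (openConn a v) := measureReal_mono hsub
        have hvk : v ∈ Finset.univ.filter fun v' : V => v' ≠ x ∧ 0 < μ.real (openConn a v') ∧ μ.real (openConn a v') < 1 :=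
          Finset.mem_filter.2 ⟨Finset.mem_univ _, hvx, hvpos, hv⟩
        have hvk1 : v ∉ Finset.univ.filter fun v' : V => v' ≠ x ∧ 0 < μ1.real (openConn a v') ∧ μ1.real (openConn a v') < 1 := by
          rw [Finset.mem_filter]; rintro ⟨-, -, -, h⟩; exact absurd hv1 (ne_of_lt h)
        have hlt : k1 < k := Finset.card_lt_card ⟨hsub1, fun h => hvk1 (h hvk)⟩
        have hk1k : (k1 : ℝ) ≤ k - 1 := by
          have : (k1 : ℝ) + 1 ≤ k := by exact_mod_cast hlt
          linarith
        exact h1.trans (mul_le_mul_of_nonneg_right hk1k hl1)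
    -- KEY LEMMA
    have hkey := osl_keyLemma w x a b z v (hglue z hz).1
    -- one-pair conditioning and the conclusion
    have eAβ := osl_real_onePair w e (A ∩ β)
    have eA := osl_real_onePair w e A
    have eβ := osl_real_onePair w e β
    have eJ := osl_real_onePair w e J
    have hident : μ.real (A ∩ β) - μ.real A * μ.real β =
        (1 - ρ) * (μ0.real (A ∩ β) - μ0.real A * μ0.real β) +
          ρ * (μ1.real (A ∩ β) - μ1.real A * μ1.real β) +
          ρ * (1 - ρ) * ((μ1.real A - μ0.real A) * (μ1.real β - μ0.real β)) := by
      rw [eAβ, eA, eβ]; ring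
    have hx1 : ρ * (1 - ρ) * ((μ1.real A - μ0.real A) * (μ1.real β - μ0.real β)) ≤ ρ * (1 - ρ) * μ1.real J :=
      mul_le_mul_of_nonneg_left hkey (mul_nonneg hρ0.le (by linarith))
    have hx2 : (1 - ρ) * (μ0.real (A ∩ β) - μ0.real A * μ0.real β) ≤ (1 - ρ) * ((k : ℝ) * μ0.real J) :=
      mul_le_mul_of_nonneg_left hφ0 (by linarith)
    have hx3 : ρ * (μ1.real (A ∩ β) - μ1.real A * μ1.real β) ≤ ρ * (((k : ℝ) - 1) * μ1.real J) :=
      mul_le_mul_of_nonneg_left hφ1 hρ0.le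
    have hx4 : 0 ≤ ρ ^ 2 * μ1.real J := mul_nonneg (sq_nonneg ρ) hl1
    rw [hident, eJ]
    nlinarith [hx1, hx2, hx3, hx4]

/-! ### The theorems -/

/-- **ONE-SIDE SIZE LEMMA, glued-count form** (PROOFS §P56; BENCH l.197 M2-R57).  For independent bond percolation with
arbitrary pair weights `w` on a finite vertex type and vertices `x, a, b`:
`μ({x↔a} ∩ {b↔x or b↔a}) − μ(x↔a)·μ(b↔x or b↔a) ≤ #{v ≠ x : 0 < μ(a↔v) < 1} · μ({b↔a} ∩ {b↮x})`
(so for a side graph `G_L` embedded in a larger vertex type the constant is at most `|L|`).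
[cite: VandenbergHaggstromKahn2005, Thm. 1.3 (p. 6)] -/
theorem oneSideCov_le_count_mul (w : Sym2 V → unitInterval) (x a b : V) :
    (prodBernoulli w).real ((openConn x a : Set (BondConfig V)) ∩ (openConn b x ∪ openConn b a)) -
        (prodBernoulli w).real (openConn x a) *
          (prodBernoulli w).real ((openConn b x : Set (BondConfig V)) ∪ openConn b a) ≤
      ((Finset.univ.filter fun v : V => v ≠ x ∧ 0 < (prodBernoulli w).real (openConn a v) ∧ (prodBernoulli w).real (openConn a v) < 1).card : ℝ) *
        (prodBernoulli w).real ((openConn b a : Set (BondConfig V)) ∩ (openConn b x)ᶜ) :=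
  osl_induct x a b _ w le_rfl

/-- **THE ONE-SIDE SIZE LEMMA** (Λ ≤ |L|; PROOFS §P54 (b) / §P56; BENCH l.192 M2-R54, l.197 M2-R57).  For independent bond
percolation with arbitrary pair weights `w` on a finite vertex type `V = {x, a} ⊔ L` (`x ≠ a`) and any vertex `b`:
`Cov(1{x↔a}, 1{b↔x or b↔a}) ≤ |L| · μ(b↔a, b↮x)`, `|L| = |V| − 2`.  Sharp along the hub–path sides (PROOFS §P54 (d1)).
[cite: VandenbergHaggstromKahn2005, Thm. 1.3 (p. 6)] -/
theorem oneSideCov_le_card_mul (w : Sym2 V → unitInterval) {x a : V} (b : V) (hxa : x ≠ a) :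
    (prodBernoulli w).real ((openConn x a : Set (BondConfig V)) ∩ (openConn b x ∪ openConn b a)) -
        (prodBernoulli w).real (openConn x a) *
          (prodBernoulli w).real ((openConn b x : Set (BondConfig V)) ∪ openConn b a) ≤
      ((Fintype.card V : ℝ) - 2) * (prodBernoulli w).real ((openConn b a : Set (BondConfig V)) ∩ (openConn b x)ᶜ) := by
  refine (oneSideCov_le_count_mul w x a b).trans (mul_le_mul_of_nonneg_right ?_ measureReal_nonneg)
  set k : ℕ := (Finset.univ.filter fun v : V => v ≠ x ∧ 0 < (prodBernoulli w).real (openConn a v) ∧ (prodBernoulli w).real (openConn a v) < 1).card with hk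
  have hsub : (Finset.univ.filter fun v : V => v ≠ x ∧ 0 < (prodBernoulli w).real (openConn a v) ∧ (prodBernoulli w).real (openConn a v) < 1) ⊆
      (Finset.univ.erase x).erase a := by
    intro v hv
    rw [Finset.mem_filter] at hv
    refine Finset.mem_erase.2 ⟨?_, Finset.mem_erase.2 ⟨hv.2.1, Finset.mem_univ _⟩⟩
    rintro rfl
    have : (prodBernoulli w).real (openConn v v : Set (BondConfig V)) = 1 := by rw [show (openConn v v : Set (BondConfig V)) = Set.univ from Set.eq_univ_of_forall fun _ => SimpleGraph.Reachable.refl _]; exact probReal_univ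
    exact absurd this (ne_of_lt hv.2.2.2)
  have hcard := Finset.card_le_card hsub
  rw [Finset.card_erase_of_mem (Finset.mem_erase.2 ⟨Ne.symm hxa, Finset.mem_univ _⟩),
    Finset.card_erase_of_mem (Finset.mem_univ _), Finset.card_univ] at hcard
  have h2 : 2 ≤ Fintype.card V := by
    have : ({x, a} : Finset V).card ≤ Fintype.card V := Finset.card_le_univ _
    rwa [Finset.card_pair hxa] at this
  have hnat : k + 2 ≤ Fintype.card V := by rw [hk]; omega
  have : (k : ℝ) + 2 ≤ Fintype.card V := by exact_mod_cast hnat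
  linarith

/-- **Equivalent form** (PROOFS §P54 (b)): `Cov(1{x↔a}, 1{x↔b}) ≤ (|V| − 2 + μ(x↔a)) · μ(b↔a, b↮x)` — since
`{b↔x or b↔a} = {x↔b} ⊔ ({b↔a} ∩ {b↮x})` and `{x↔a} ∩ {b↔a} ∩ {b↮x} = ∅`.
[cite: VandenbergHaggstromKahn2005, Thm. 1.3 (p. 6)] -/
theorem cov_conn_le_card_add_mul (w : Sym2 V → unitInterval) {x a : V} (b : V) (hxa : x ≠ a) :
    (prodBernoulli w).real ((openConn x a : Set (BondConfig V)) ∩ openConn x b) -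
        (prodBernoulli w).real (openConn x a) * (prodBernoulli w).real (openConn x b) ≤
      ((Fintype.card V : ℝ) - 2 + (prodBernoulli w).real (openConn x a)) *
        (prodBernoulli w).real ((openConn b a : Set (BondConfig V)) ∩ (openConn b x)ᶜ) := by
  have h := oneSideCov_le_card_mul w b hxa
  set μ := prodBernoulli w with hμ
  have hX : (openConn x b : Set (BondConfig V)) = openConn b x := Set.ext fun _ => SimpleGraph.reachable_comm
  have hβ : ((openConn b x : Set (BondConfig V)) ∪ openConn b a) =
      (openConn b x : Set (BondConfig V)) ∪ ((openConn b a : Set (BondConfig V)) ∩ (openConn b x)ᶜ) := by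
    ext ω; constructor
    · rintro (h1 | h2)
      · exact Or.inl h1
      · by_cases h3 : ω ∈ (openConn b x : Set (BondConfig V))
        · exact Or.inl h3
        · exact Or.inr ⟨h2, h3⟩
    · rintro (h1 | ⟨h2, -⟩)
      · exact Or.inl h1
      · exact Or.inr h2
  have hdisj : Disjoint (openConn b x : Set (BondConfig V)) ((openConn b a : Set (BondConfig V)) ∩ (openConn b x)ᶜ) :=
    Set.disjoint_left.2 fun ω h1 h2 => h2.2 h1
  have hμβ : μ.real ((openConn b x : Set (BondConfig V)) ∪ openConn b a) =
      μ.real (openConn b x) + μ.real ((openConn b a : Set (BondConfig V)) ∩ (openConn b x)ᶜ) := by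
    rw [hβ, measureReal_union hdisj MeasurableSet.of_discrete]
  have hAβ : (openConn x a : Set (BondConfig V)) ∩ (openConn b x ∪ openConn b a) =
      (openConn x a : Set (BondConfig V)) ∩ openConn b x := by
    ext ω; constructor
    · rintro ⟨h1, h2 | h3⟩
      · exact ⟨h1, h2⟩
      · exact ⟨h1, SimpleGraph.Reachable.trans h3 (SimpleGraph.Reachable.symm h1)⟩
    · rintro ⟨h1, h2⟩; exact ⟨h1, Or.inl h2⟩
  rw [hAβ, hμβ] at h
  rw [hX]
  have hJ : 0 ≤ μ.real ((openConn b a : Set (BondConfig V)) ∩ (openConn b x)ᶜ) := measureReal_nonneg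
  nlinarith [h, hJ]

end Summit.CriticalPhenomena.PercolationContinuityZ3.Theorems.CSH
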